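import Literature.NumberTheory.Automorphic.HarrisLanTaylorThorneTwistedPairLimitMisstated
import Literature.NumberTheory.EllipticCurves.NewformGaloisRepModLOfTheoremA
import Literature.NumberTheory.EllipticCurves.NewformsProofs
import Literature.NumberTheory.EllipticCurves.MurtySinhaMultiplicityHeckeProofs
import Literature.NumberTheory.EllipticCurves.NewformsLiftProofs
import Literature.NumberTheory.EllipticCurves.ModularCurveProofs
import Literature.NumberTheory.Automorphic.ReciprocityGLnExistenceProofs
import Literature.NumberTheory.Automorphic.BaseChangeStrongCuspidalPrime
import Literature.FieldTheory.AlgClosed.PadicAlgClEquivComplex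
import HarnessLib

/-!
# The mis-stated fact `HarrisLanTaylorThorne2016_twistedPairLimit_two` contradicts quadratic base
# change (Arthur–Clozel): a refutation modulo two named leaves of the same route

Topic `Literature/NumberTheory/Automorphic`; theorems only (no definition, no named fact, no
instance; D-0026).  Sibling of `HarrisLanTaylorThorneTwistedPairLimitMisstated`, which proves that the
named fact `HarrisLanTaylorThorne2016_twistedPairLimit_two` (as typed: the Frobenius polynomial of
Cor. 6.27's `R_{p,ı}(π, N)` in place of that of `R_{p,ı}(π, N) ⊗ ε_p^{N}`, Harris–Lan–Taylor–Thorne,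
Res. Math. Sci. 3:37 (2016), proof of Cor. 6.27, p. 225) yields `False` together with ANY instance of
its data (`HarrisLanTaylorThorne2016_twistedPairLimit_two.elim`), i.e. is equivalent to the
non-existence of regular algebraic cuspidal automorphic representations of `GL₂` over CM fields
(`HarrisLanTaylorThorne2016_twistedPairLimit_two_iff_forall_not_isRegularAlgebraic`).

Here such an instance is PRODUCED from the tree, modulo exactly the two Arthur–Clozel leaves that the
dependent `Summit.Langlands.….GaloisRepGL2CMae_of_facts'` already takes as hypotheses next to the
mis-stated fact (`ArthurClozel1989_strongLifting_cuspidal`, Ann. of Math. Stud. 120, Ch. 3,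
Thm. 4.2 (a) with Thm. 5.1; `ArthurClozel1989_strongLifting_archimedean`, ibid. Thm. 5.1 archimedean
clause):

1. `exists_levelOne_heckeEigenform_weight_twelve` — Ramanujan's `Δ ∈ S₁₂(SL₂(ℤ))` (Mathlib
   `CuspForm.discriminant`, `CuspForm.exists_smul_discriminant_of_weight_eq_twelve`: the space is a
   line) transported to the tree's level `Γ₀(1)` (`coe_gamma0_one`) and lifted to `Γ₁(1)`
   (`liftToGamma1`, `heckeT_liftToGamma1`) is a non-zero eigenform of every `T_p` with trivial
   nebentypus;
2. the tree's PROVED dictionary `f ↦ π_f` (`DeligneSerre1974.hdict_holds`, Gelbart 1975 §3 /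
   Gelbart 1997 Prop. 2.5) turns it into a regular algebraic cuspidal automorphic representation
   `π_Δ` of `GL₂(𝔸_ℚ)`, unramified at every prime;
3. `not_isUnramifiedIn_sqrtNegField_rat` — for a prime `D`, the imaginary quadratic field `ℚ(√-D)`
   (the member `sqrtNegField ℚ D` of the tree's quadratic family) is ramified above `D` (`ℚ` has
   discriminant `1`, so `v_D(D) = 1`, and `PatchingFamily.not_isUnramifiedIn_sqrtNegField`), so
   Arthur–Clozel's strong lifting
   (`ArthurClozel1989_strongLifting_cuspidal.exists_cuspidal_regularAlgebraic`) gives a regular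
   algebraic CUSPIDAL `BC(π_Δ)` on `GL₂(𝔸_{ℚ(√-D)})`
   (`exists_isRegularAlgebraic_cuspidal_sqrtNegField_of_arthurClozel` — of independent use: the
   existence of regular algebraic cuspidal representations of `GL₂` over imaginary quadratic fields,
   modulo the base-change leaves only);
4. `ℚ(√-23)/ℚ` is CM in the fact's presentation (totally complex, degree `2`, non-trivial
   conjugation `PatchingFamily.conjAlgEquiv`), contains the imaginary quadratic `ℚ(√-23)` in which
   `3` splits (`8·3 ∣ 24`, `PatchingFamily.exists_intermediateField_hasTwoPrimesOver`), and
   `ℚ̄₃ ≃+* ℂ` exists (`PadicAlgCl.nonempty_ringEquiv_complex`); feeding all this to `.elim` gives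

* `HarrisLanTaylorThorne2016_twistedPairLimit_two.not_of_arthurClozel` :
  `ArthurClozel1989_strongLifting_cuspidal → ArthurClozel1989_strongLifting_archimedean →
   ¬ HarrisLanTaylorThorne2016_twistedPairLimit_two`,

and the hypothesis set `{h₁, h₃, h₄}` of `GaloisRepGL2CMae_of_facts'` is jointly contradictory
(`HarrisLanTaylorThorne2016_twistedPairLimit_two.false_of_arthurClozel`).  Since Arthur–Clozel base
change is an established theorem, the typed fact is FALSE (not merely unprovable); the corrected
statement is `HarrisLanTaylorThorne2016_inducedPairLimit_two` (fact file).

Verdict clean-up (2026-08-17).  Following the verdict `refuted`, the fact is RETIRED FROM LITERATURE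
DEBT: it is kept statement byte-for-byte in `HarrisLanTaylorThorneTwistedPairLimit.lean` but carries
`@[deprecated]`, whose message points HERE (`….not_of_arthurClozel`), to `.elim` /
`_iff_forall_not_isRegularAlgebraic` of the `…Misstated` sibling and to the corrected
`HarrisLanTaylorThorne2016_inducedPairLimit_two`; the two theorems of §4 below that must name it —
they ARE its refutation — switch `linter.deprecated` off for themselves alone (each with a REMOVE-WHEN
note); nothing else changed.

## References

* M. Harris, K.-W. Lan, R. Taylor, J. Thorne, *On the rigid cohomology of certain Shimura
  varieties*, Res. Math. Sci. 3:37 (2016), §6.1 and Cor. 6.26–6.27 with its proof (p. 225).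
  [HarrisLanTaylorThorneRMS2016]
* J. Arthur, L. Clozel, *Simple algebras, base change, and the advanced theory of the trace
  formula*, Ann. of Math. Stud. 120 (1989), Ch. 3, Thm. 4.2 (a), Thm. 5.1. [ArthurClozelAMS120]
* S. Gelbart, *Automorphic forms on adele groups* (1975), §3. [Gelbart1975]
-/

noncomputable section

open scoped MatrixGroups ModularForm NumberField
open CongruenceSubgroup NumberField IsDedekindDomain Field
open Literature.NumberTheory.GaloisRepresentations
open Literature.NumberTheory.GaloisRepresentations.QuadraticFamily
open Literature.NumberTheory.EllipticCurves.ModularForms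

namespace Literature.NumberTheory.Automorphic

/-! ### 1. A level-one Hecke eigenform of weight `12` for `Γ₁(1)` (Ramanujan's `Δ`) -/

/-- **`S₁₂(Γ₀(1))` is the line spanned by `Δ`** (Mathlib: `S₁₂(SL₂(ℤ)) = ℂ Δ`,
`CuspForm.exists_smul_discriminant_of_weight_eq_twelve`, transported along `Γ₀(1) = SL₂(ℤ)`, the
tree's `coe_gamma0_one`, with Mathlib's `CuspForm.mcast`). [folklore] -/
theorem exists_smul_eq_of_gamma0_one_weight_twelve (f g : CuspForm (Gamma0 1) 12)
    (hg : (⇑g : UpperHalfPlane → ℂ) = ModularForm.discriminant) : ∃ c : ℂ, f = c • g := by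
  obtain ⟨c, hc⟩ := CuspForm.exists_smul_discriminant_of_weight_eq_twelve
    (CuspForm.mcast rfl f coe_gamma0_one.symm)
  refine ⟨c, DFunLike.ext' ?_⟩
  have h : ((c • CuspForm.discriminant : CuspForm 𝒮ℒ 12) : UpperHalfPlane → ℂ) =
      ((CuspForm.mcast rfl f coe_gamma0_one.symm : CuspForm 𝒮ℒ 12) : UpperHalfPlane → ℂ) := by
    rw [hc]
  rw [CuspForm.IsGLPos.coe_smul, CuspForm.coe_discriminant] at h
  rw [CuspForm.IsGLPos.coe_smul, hg, h]
  rfl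

/-- **Ramanujan's `Δ` as a Hecke eigenform of level `Γ₁(1)`, weight `12`, trivial nebentypus.**
There is a non-zero `g ∈ S₁₂(Γ₁(1))` — namely `Δ ∈ S₁₂(Γ₀(1))` lifted to `Γ₁(1)`, so that it lies in
`S₁₂(1, 𝟙)` (`MurtySinha.liftToGamma1_mem_nebentypusSubspace_one`) — which is an eigenvector of every
`T_p`: `T_p` commutes with the lift (`heckeT_liftToGamma1`) and `S₁₂(Γ₀(1))` is the line `ℂ Δ`
(`exists_smul_eq_of_gamma0_one_weight_twelve`).
[cite: DiamondShurman2005, §5.8 (S₁₂(SL₂(ℤ)) = ℂΔ is spanned by a normalised eigenform) and Exercise 5.2.4] -/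
theorem exists_levelOne_heckeEigenform_weight_twelve :
    ∃ g : CuspForm (Gamma1 1) 12, g ≠ 0 ∧ g ∈ nebentypusSubspace 1 12 1 ∧
      ∃ a : ℕ → ℂ, ∀ (p : ℕ) (hp : p.Prime),
        (haveI : NeZero p := ⟨hp.ne_zero⟩;
          Literature.NumberTheory.EllipticCurves.ModularForms.heckeT (Gamma1 1) 12 p g) = a p • g := by
  classical
  -- `Δ` at level `Γ₀(1)`
  set Δ₀ : CuspForm (Gamma0 1) 12 := CuspForm.mcast rfl CuspForm.discriminant coe_gamma0_one with hΔ₀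
  have hΔ₀coe : (⇑Δ₀ : UpperHalfPlane → ℂ) = ModularForm.discriminant := rfl
  have hΔ₀0 : Δ₀ ≠ 0 := by
    intro h
    have h1 : (⇑Δ₀ : UpperHalfPlane → ℂ) UpperHalfPlane.I = 0 := by rw [h]; rfl
    rw [hΔ₀coe] at h1
    exact ModularForm.discriminant_ne_zero _ h1
  -- every `Γ₀(1)`-cusp form of weight `12` lies on the line `ℂ Δ₀`
  have key : ∀ f : CuspForm (Gamma0 1) 12, ∃ c : ℂ, f = c • Δ₀ :=
    fun f => exists_smul_eq_of_gamma0_one_weight_twelve f Δ₀ hΔ₀coe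
  choose c hc using key
  refine ⟨liftToGamma1 1 12 Δ₀, liftToGamma1_ne_zero (N := 1) (k := 12) hΔ₀0,
    MurtySinha.liftToGamma1_mem_nebentypusSubspace_one 1 12 Δ₀,
    fun p => if h : p = 0 then 0 else
      c (haveI : NeZero p := ⟨h⟩; Literature.NumberTheory.EllipticCurves.ModularForms.heckeT (Gamma0 1) 12 p Δ₀),
    fun p hp => ?_⟩
  haveI : NeZero p := ⟨hp.ne_zero⟩
  dsimp only
  rw [dif_neg hp.ne_zero, heckeT_liftToGamma1 1 12 p Δ₀, ← map_smul]
  exact congrArg (liftToGamma1 1 12) (hc _)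

/-! ### 2. The imaginary quadratic field `ℚ(√-23)` -/

/-- **`ℚ(√-D)/ℚ` is ramified above the prime `D`**: the place `v ∋ D` of `ℚ` has `v(D) = 1`
(`disc ℚ = 1`, Mathlib `Rat.numberField_discr`, `NumberField.not_dvd_discr_iff_forall_mem`;
`PatchingFamily.intValuation_natCast_eq_of_isUnramifiedAt`), hence is ramified in `ℚ(√-D)`
(`PatchingFamily.not_isUnramifiedIn_sqrtNegField`: `ω² = -D` has odd valuation). [folklore] -/
theorem not_isUnramifiedIn_sqrtNegField_rat {D : ℕ} (hD : D.Prime) [Fact (¬ IsSquare (-(D : ℚ)))]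
    (v : HeightOneSpectrum (𝓞 ℚ)) (hv : ((D : ℕ) : 𝓞 ℚ) ∈ v.asIdeal) :
    ¬ Algebra.IsUnramifiedIn (𝓞 (sqrtNegField ℚ D)) v.asIdeal := by
  have hDZ : Prime (D : ℤ) := Nat.prime_iff_prime_int.mp hD
  have hdisc : ¬ (D : ℤ) ∣ NumberField.discr ℚ := by
    rw [Rat.numberField_discr]
    exact fun h => hD.one_lt.ne' (by exact_mod_cast Int.eq_one_of_dvd_one (Int.natCast_nonneg D) h)
  have hunr : Algebra.IsUnramifiedAt ℤ v.asIdeal :=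
    (NumberField.not_dvd_discr_iff_forall_mem ℚ (𝓞 ℚ) hDZ).mp hdisc v.asIdeal v.isPrime
      (by simpa using hv)
  exact PatchingFamily.not_isUnramifiedIn_sqrtNegField v
    (PatchingFamily.intValuation_natCast_eq_of_isUnramifiedAt hD v hv hunr)

/-- The conjugation `√-D ↦ -√-D` of `ℚ(√-D)` is not the identity. [folklore] -/
theorem conjAlgEquiv_refl_ne_one {D : ℕ} [Fact (¬ IsSquare (-(D : ℚ)))] :
    (PatchingFamily.conjAlgEquiv (K := ℚ) (D := D) (RingEquiv.refl ℚ)) ≠ 1 := by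
  intro h
  have h1 := congrArg (fun e : sqrtNegField ℚ D ≃ₐ[ℚ] sqrtNegField ℚ D =>
    (e QuadraticAlgebra.omega).im) h
  simp only [PatchingFamily.conjAlgEquiv_apply, PatchingFamily.conjRingEquiv_apply_im,
    AlgEquiv.one_apply, RingEquiv.refl_apply] at h1
  change -(1 : ℚ) = 1 at h1
  norm_num at h1

/-! ### 3. Regular algebraic cuspidal representations of `GL₂` over `ℚ(√-D)` exist, modulo Arthur–Clozel -/

/-- **Regular algebraic cuspidal automorphic representations of `GL₂(𝔸_{ℚ(√-D)})` exist for every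
prime `D`, granted Arthur–Clozel's base change** (`ArthurClozel1989_strongLifting_cuspidal`, Ann. of
Math. Stud. 120, Ch. 3, Thm. 4.2 (a) with Thm. 5.1: strong cuspidal lifting in prime degree for `π`
unramified at a place ramified in `E`; `ArthurClozel1989_strongLifting_archimedean`: its archimedean
clause): the base change to `ℚ(√-D)` — ramified above `D` (`not_isUnramifiedIn_sqrtNegField_rat`) —
of the regular algebraic cuspidal representation `π_Δ` of `GL₂(𝔸_ℚ)` attached to Ramanujan's `Δ` by
the tree's PROVED dictionary (`DeligneSerre1974.hdict_holds`, Gelbart 1975, §3; `π_Δ` is unramified at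
every prime, `exists_levelOne_heckeEigenform_weight_twelve`).  Everything but the two named leaves is a
theorem of the tree or of Mathlib.
[cite: ArthurClozelAMS120, Ch. 3 Thm. 4.2 (a), Thm. 5.1] [cite: Gelbart1975, §3, Prop. 3.1] -/
theorem exists_isRegularAlgebraic_cuspidal_sqrtNegField_of_arthurClozel
    (hBC : ArthurClozel1989_strongLifting_cuspidal)
    (harch : ArthurClozel1989_strongLifting_archimedean) {D : ℕ} (hD : D.Prime)
    [Fact (¬ IsSquare (-(D : ℚ)))] (hE : isCompact_glFiniteIntegralLevel 2 (sqrtNegField ℚ D)) :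
    ∃ P : CuspidalAutomorphicRepData 2 (sqrtNegField ℚ D) hE, P.1.IsRegularAlgebraic := by
  classical
  -- 1. `π_Δ`: a regular algebraic cuspidal representation of `GL₂(𝔸_ℚ)`, unramified at every prime
  obtain ⟨g, hg0, hgmem, a, ha⟩ := exists_levelOne_heckeEigenform_weight_twelve
  obtain ⟨π, hπRA, hπsat⟩ :=
    Literature.NumberTheory.EllipticCurves.ModularForms.DeligneSerre1974.hdict_holds
      (isCompact_glFiniteIntegralLevel_holds 2 ℚ) 1 12 (by norm_num) g 1 hgmem hg0 a
      fun p hp _ => ha p hp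
  -- 2. `ℚ(√-D)/ℚ` is ramified above `D`, where `π_Δ` is unramified
  obtain ⟨v, hv⟩ := PatchingFamily.exists_heightOneSpectrum_natCast_mem ℚ hD
  have hram : ¬ Algebra.IsUnramifiedIn (𝓞 (sqrtNegField ℚ D)) v.asIdeal :=
    not_isUnramifiedIn_sqrtNegField_rat hD v hv
  have hπv : π.1.IsUnramifiedAt v :=
    ⟨_, hπsat v (Rat.HeightOneSpectrum.primesEquiv v).2.not_dvd_one⟩
  -- 3. base change (Arthur–Clozel): a regular algebraic CUSPIDAL `P` on `GL₂(𝔸_{ℚ(√-D)})`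
  haveI : Algebra.IsQuadraticExtension ℚ (sqrtNegField ℚ D) := ⟨finrank_sqrtNegField⟩
  haveI : IsGalois ℚ (sqrtNegField ℚ D) := Algebra.IsQuadraticExtension.isGalois ℚ _
  obtain ⟨P, -, -, hPRA⟩ :=
    ArthurClozel1989_strongLifting_cuspidal.exists_cuspidal_regularAlgebraic hBC harch
      (by rw [finrank_sqrtNegField]; norm_num) π hπRA hram hπv hE
  exact ⟨P, hPRA⟩

/-! ### 4. The refutation modulo Arthur–Clozel base change -/

-- names the `@[deprecated]` record `HarrisLanTaylorThorne2016_twistedPairLimit_two` of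
-- `HarrisLanTaylorThorneTwistedPairLimit.lean` on purpose: this IS the refuting theorem its deprecation
-- message points to (verdict clean-up 2026-08-17); REMOVE-WHEN the record is deleted from that file
set_option linter.deprecated false in
/-- **The mis-stated fact contradicts quadratic base change.**  Granted Arthur–Clozel's strong
cuspidal lifting in prime degree at the unramified places (`ArthurClozel1989_strongLifting_cuspidal`,
Ann. of Math. Stud. 120, Ch. 3, Thm. 4.2 (a) with Thm. 5.1) and its archimedean clause
(`ArthurClozel1989_strongLifting_archimedean`), the named fact
`HarrisLanTaylorThorne2016_twistedPairLimit_two` is FALSE: `ℚ(√-23)/ℚ` is CM in the presentation of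
the fact (totally complex, degree `2`, conjugation `≠ 1`), contains the imaginary quadratic field
`ℚ(√-23)` in which `3` splits (`8·3 ∣ 24`), `ℚ̄₃ ≃+* ℂ` exists (Steinitz), and by
`exists_isRegularAlgebraic_cuspidal_sqrtNegField_of_arthurClozel` there is a regular algebraic
cuspidal automorphic representation of `GL₂(𝔸_{ℚ(√-23)})` — an instance of the data of the fact,
which `HarrisLanTaylorThorne2016_twistedPairLimit_two.elim` turns into `False`.  (The HLTT-faithful
statement is `HarrisLanTaylorThorne2016_inducedPairLimit_two`: prescription twisted by `ε_p^{N}`,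
proof of Cor. 6.27, p. 225.)
[cite: HarrisLanTaylorThorneRMS2016, Cor. 6.26–6.27 and proof of Cor. 6.27 (p. 225); §1.3 (BC(Π)_w conjugate self-dual)]
[cite: ArthurClozelAMS120, Ch. 3 Thm. 4.2 (a), Thm. 5.1] -/
theorem HarrisLanTaylorThorne2016_twistedPairLimit_two.not_of_arthurClozel
    (hBC : ArthurClozel1989_strongLifting_cuspidal)
    (harch : ArthurClozel1989_strongLifting_archimedean) :
    ¬ HarrisLanTaylorThorne2016_twistedPairLimit_two := by
  classical
  intro h
  haveI : Fact (¬ IsSquare (-((23 : ℕ) : ℚ))) :=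
    ⟨by rintro ⟨r, hr⟩; push_cast at hr; nlinarith [mul_self_nonneg r]⟩
  -- a regular algebraic cuspidal `P` on `GL₂(𝔸_E)`, `E = ℚ(√-23)`
  obtain ⟨P, hPRA⟩ := exists_isRegularAlgebraic_cuspidal_sqrtNegField_of_arthurClozel hBC harch
    (by norm_num : Nat.Prime 23) (isCompact_glFiniteIntegralLevel_holds 2 (sqrtNegField ℚ 23))
  -- the CM data of the fact: `E/ℚ`, `E₀ = ℚ(√-23) ⊆ E` with `3` split, `ι : ℚ̄₃ ≃ ℂ`
  obtain ⟨E₀, hE₀, hsplit⟩ :=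
    PatchingFamily.exists_intermediateField_hasTwoPrimesOver (K := ℚ) (D := 23) (by norm_num)
  obtain ⟨ι⟩ := PadicAlgCl.nonempty_ringEquiv_complex 3
  exact h.elim ℚ (sqrtNegField ℚ 23) (PatchingFamily.conjAlgEquiv (RingEquiv.refl ℚ)) inferInstance
    finrank_sqrtNegField conjAlgEquiv_refl_ne_one
    (PatchingFamily.isTotallyComplex_sqrtNegField (K := ℚ) (D := 23) (by norm_num))
    (isCompact_glFiniteIntegralLevel_holds 2 _) 3 E₀ hE₀ (hsplit 3 Nat.prime_three (by norm_num)) P hPRA ι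

-- names the `@[deprecated]` record `HarrisLanTaylorThorne2016_twistedPairLimit_two` of
-- `HarrisLanTaylorThorneTwistedPairLimit.lean` on purpose: it records that the hypothesis set of the
-- Summits theorem `GaloisRepGL2CMae_of_facts'` is contradictory (verdict clean-up 2026-08-17);
-- REMOVE-WHEN the record is deleted from that file
set_option linter.deprecated false in
/-- **The hypotheses `h₁, h₃, h₄` of `GaloisRepGL2CMae_of_facts'` are jointly contradictory**: the
mis-stated fact together with the two Arthur–Clozel leaves proves `False`
(`not_of_arthurClozel`). [cite: HarrisLanTaylorThorneRMS2016, proof of Cor. 6.27 (p. 225)] -/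
theorem HarrisLanTaylorThorne2016_twistedPairLimit_two.false_of_arthurClozel
    (h : HarrisLanTaylorThorne2016_twistedPairLimit_two)
    (hBC : ArthurClozel1989_strongLifting_cuspidal)
    (harch : ArthurClozel1989_strongLifting_archimedean) : False :=
  HarrisLanTaylorThorne2016_twistedPairLimit_two.not_of_arthurClozel hBC harch h

end Literature.NumberTheory.Automorphic
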